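import Mathlib
import Summits.Ventures.HodgeRepro2.Tier7.Line3.HyperbolicSize

/-!
# Tier 7 — LINE 3 support: packing coordinates for `M₂(ℝ) = ℝ⁴` and left multiplication by `SL(2, ℝ)`
(`Line3/DiscreteSubgroupPacking.lean`; t7-L1-p1, gen 3; Mathlib + Line3/HyperbolicSize — part 1 of 2, the
geometry; part 2 = `Line3/DiscreteSubgroupCount.lean`, the count)

PURPOSE. `Line3/ModularGroupCount.lean` (p676642) counts `SL(2, ℤ)` in the cosh-size `κ g = (a² + b² + c² + d²) / 2` of
`Line3/HyperbolicSize.lean` with the sharp exponent `β = 1`, by the arithmetic of integer entries. The real lattice of the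
line (`U(W_A)(F)` at a `(1,1)`-place, the dictionary's object) is NOT `SL(2, ℤ)`; the only property of it the Poincaré-series
kernel uses is that it is DISCRETE in the real group. Part 2 proves the sharp count for EVERY discrete subgroup of `SL(2, ℝ)`
by PACKING in `M₂(ℝ) = ℝ⁴` with Lebesgue measure (no Haar measure on `SL(2, ℝ)`, no hyperbolic area). THIS FILE holds the
geometry the packing needs:
* `M₂(ℝ)` coordinatised by `E = ℝ² × ℝ²` (two Euclidean planes `(p, q)`) through the ORTHOGONAL coordinates
  `a = (p₀ + q₀)/2, d = (p₀ − q₀)/2, b = (q₁ + p₁)/2, c = (q₁ − p₁)/2` (`Ψ : E ≃ₗ[ℝ] F`, `F` = the two columns,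
  `mat : F → M₂(ℝ)`), in which `4 det = ‖p‖² − ‖q‖²` and `2 (a² + b² + c² + d²) = ‖p‖² + ‖q‖²` (`det_mat_Ψ`, `sum_sq_mat_Ψ`);
* left multiplication by `γ ∈ SL(2, ℝ)` as a linear map of `E` (`actE γ`, an action: `actE_mul`, `actE_one`) of determinant
  `(det γ)² = 1` (on the two columns: `LinearMap.det_prodMap`, `LinearMap.det_toLin'`, then `LinearMap.det_conj`), hence
  LEBESGUE-MEASURE PRESERVING (`MeasureTheory.Measure.addHaar_image_linearMap`: `volume_image_actE`);
* the ball `B = ball z₁ ε` around the identity `z₁ = ((2, 0), (0, 0))`: the matrix of each of its points has entries within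
  `ε` of the identity (`entries_close`);
* the `2 × 2` algebra: a matrix within `ε ≤ 1/8` of the identity has `|det − 1| < 4 ε` and `det ≥ 1/2` (`det_close`), the
  EXPLICIT INVERSE — `δ Y = Y'` with `Y, Y'` within `ε` of `1` forces `δ` within `6 ε` of `1` (`inv_close`) —,
  Cauchy–Schwarz for the `2 × 2` product `Σ (g y)² ≤ Σ g² · Σ y²` (`sum_sq_mul_le`), and `Σ Y² ≤ 4` (`sum_sq_le_four`).
Nothing here is about the real `X`, `U(W_A)(F)`, (N) or (P) (TYPING-CENSUS T7).

Sorry-free; axioms: propext / Classical.choice / Quot.sound. §8(d): uses an L-value-free non-vanishing device: NO.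
-/

namespace Summit.Ventures.HodgeRepro2.Tier7.Line3.DiscreteSubgroupPacking

open MeasureTheory Metric Matrix Summit.Ventures.HodgeRepro2.Tier7.Line3.HyperbolicSize
open scoped MatrixGroups

noncomputable section

/-! ## 1. The model space `E = ℝ² × ℝ²` and the orthogonal coordinates of `M₂(ℝ)` -/

/-- the Euclidean plane -/
abbrev E₂ := EuclideanSpace ℝ (Fin 2)

/-- the model of `M₂(ℝ)`: two Euclidean planes `(p, q)` -/
abbrev E := E₂ × E₂

/-- the two columns of a `2 × 2` matrix -/
abbrev F := (Fin 2 → ℝ) × (Fin 2 → ℝ)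

/-- the matrix with columns `c.1`, `c.2` -/
def mat (c : F) : Matrix (Fin 2) (Fin 2) ℝ := Matrix.of ![![c.1 0, c.2 0], ![c.1 1, c.2 1]]

/-- entry `(0,0)` of `mat c` -/
@[simp] theorem mat_apply_00 (c : F) : mat c 0 0 = c.1 0 := rfl
/-- entry `(0,1)` of `mat c` -/
@[simp] theorem mat_apply_01 (c : F) : mat c 0 1 = c.2 0 := rfl
/-- entry `(1,0)` of `mat c` -/
@[simp] theorem mat_apply_10 (c : F) : mat c 1 0 = c.1 1 := rfl
/-- entry `(1,1)` of `mat c` -/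
@[simp] theorem mat_apply_11 (c : F) : mat c 1 1 = c.2 1 := rfl

/-- the orthogonal coordinates `(p, q) ↦` the columns of `[[ (p₀+q₀)/2, (q₁+p₁)/2 ], [ (q₁−p₁)/2, (p₀−q₀)/2 ]]`,
with inverse `p = (a + d, b − c)`, `q = (a − d, b + c)` -/
def Ψ : E ≃ₗ[ℝ] F where
  toFun z := (![(z.1 0 + z.2 0) / 2, (z.2 1 - z.1 1) / 2], ![(z.2 1 + z.1 1) / 2, (z.1 0 - z.2 0) / 2])
  invFun c := (!₂[c.1 0 + c.2 1, c.2 0 - c.1 1], !₂[c.1 0 - c.2 1, c.2 0 + c.1 1])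
  map_add' x y := by
    ext i <;> fin_cases i <;> simp [PiLp.add_apply] <;> ring
  map_smul' r x := by
    ext i <;> fin_cases i <;> simp [PiLp.smul_apply] <;> ring
  left_inv z := by
    ext i <;> fin_cases i <;> simp <;> ring
  right_inv c := by
    ext i <;> fin_cases i <;> simp

/-- the first column of `Ψ z` -/
theorem Ψ_apply_1 (z : E) (i : Fin 2) :
    (Ψ z).1 i = ![(z.1 0 + z.2 0) / 2, (z.2 1 - z.1 1) / 2] i := rfl

/-- the second column of `Ψ z` -/
theorem Ψ_apply_2 (z : E) (i : Fin 2) :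
    (Ψ z).2 i = ![(z.2 1 + z.1 1) / 2, (z.1 0 - z.2 0) / 2] i := rfl

/-- the `p`-coordinates of `Ψ.symm c` -/
theorem Ψ_symm_apply_1 (c : F) (i : Fin 2) :
    (Ψ.symm c).1 i = ![c.1 0 + c.2 1, c.2 0 - c.1 1] i := rfl

/-- the `q`-coordinates of `Ψ.symm c` -/
theorem Ψ_symm_apply_2 (c : F) (i : Fin 2) :
    (Ψ.symm c).2 i = ![c.1 0 - c.2 1, c.2 0 + c.1 1] i := rfl

/-- the squared Euclidean norm in the plane -/
theorem norm_sq_E₂ (p : E₂) : ‖p‖ ^ 2 = p 0 ^ 2 + p 1 ^ 2 := by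
  rw [EuclideanSpace.real_norm_sq_eq, Fin.sum_univ_two]

/-- `4 det Y = ‖p‖² − ‖q‖²` in the orthogonal coordinates -/
theorem det_mat_Ψ (z : E) : 4 * (mat (Ψ z)).det = ‖z.1‖ ^ 2 - ‖z.2‖ ^ 2 := by
  rw [Matrix.det_fin_two, norm_sq_E₂, norm_sq_E₂]
  simp only [mat_apply_00, mat_apply_01, mat_apply_10, mat_apply_11, Ψ_apply_1, Ψ_apply_2]
  simp
  ring

/-- `2 Σ Y_ij² = ‖p‖² + ‖q‖²` in the orthogonal coordinates -/
theorem sum_sq_mat_Ψ (z : E) :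
    2 * (mat (Ψ z) 0 0 ^ 2 + mat (Ψ z) 0 1 ^ 2 + mat (Ψ z) 1 0 ^ 2 + mat (Ψ z) 1 1 ^ 2) =
      ‖z.1‖ ^ 2 + ‖z.2‖ ^ 2 := by
  rw [norm_sq_E₂, norm_sq_E₂]
  simp only [mat_apply_00, mat_apply_01, mat_apply_10, mat_apply_11, Ψ_apply_1, Ψ_apply_2]
  simp
  ring

/-! ## 2. Left multiplication by `SL(2, ℝ)` on the columns and on `E`; its determinant is `1` -/

/-- left multiplication by `γ` on the two columns -/
def actF (γ : SL(2, ℝ)) : F →ₗ[ℝ] F :=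
  LinearMap.prodMap (Matrix.toLin' (γ : Matrix (Fin 2) (Fin 2) ℝ)) (Matrix.toLin' (γ : Matrix (Fin 2) (Fin 2) ℝ))

/-- `actF γ` multiplies both columns by `γ` -/
theorem actF_apply (γ : SL(2, ℝ)) (c : F) :
    actF γ c = ((γ : Matrix (Fin 2) (Fin 2) ℝ) *ᵥ c.1, (γ : Matrix (Fin 2) (Fin 2) ℝ) *ᵥ c.2) := by
  simp [actF, Matrix.toLin'_apply]

/-- `mat (actF γ c) = γ * mat c` -/
theorem mat_actF (γ : SL(2, ℝ)) (c : F) : mat (actF γ c) = (γ : Matrix (Fin 2) (Fin 2) ℝ) * mat c := by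
  ext i j
  fin_cases i <;> fin_cases j <;>
    simp [mat, actF_apply, Matrix.mul_apply, Fin.sum_univ_two]

/-- `actF` is an action: `actF γ ∘ actF γ' = actF (γ γ')` -/
theorem actF_mul (γ γ' : SL(2, ℝ)) (c : F) : actF γ (actF γ' c) = actF (γ * γ') c := by
  rw [actF_apply, actF_apply, actF_apply, Matrix.mulVec_mulVec, Matrix.mulVec_mulVec,
    Matrix.SpecialLinearGroup.coe_mul]

/-- `actF 1 = id` -/
theorem actF_one (c : F) : actF 1 c = c := by
  rw [actF_apply, Matrix.SpecialLinearGroup.coe_one, Matrix.one_mulVec, Matrix.one_mulVec]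

/-- left multiplication by `γ` in the orthogonal coordinates -/
def actE (γ : SL(2, ℝ)) : E →ₗ[ℝ] E := (Ψ.symm : F →ₗ[ℝ] E) ∘ₗ actF γ ∘ₗ (Ψ : E →ₗ[ℝ] F)

/-- `actE γ` unfolded -/
theorem actE_apply (γ : SL(2, ℝ)) (z : E) : actE γ z = Ψ.symm (actF γ (Ψ z)) := rfl

/-- `Ψ` intertwines `actE` and `actF` -/
theorem Ψ_actE (γ : SL(2, ℝ)) (z : E) : Ψ (actE γ z) = actF γ (Ψ z) := by
  rw [actE_apply, LinearEquiv.apply_symm_apply]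

/-- `actE` is an action: `actE γ ∘ actE γ' = actE (γ γ')` -/
theorem actE_mul (γ γ' : SL(2, ℝ)) (z : E) : actE γ (actE γ' z) = actE (γ * γ') z := by
  simp only [actE_apply, LinearEquiv.apply_symm_apply, actF_mul]

/-- `actE 1 = id` -/
theorem actE_one (z : E) : actE 1 z = z := by
  simp only [actE_apply, actF_one, LinearEquiv.symm_apply_apply]

/-- `actE γ⁻¹` is a left inverse of `actE γ` -/
theorem actE_inv_actE (γ : SL(2, ℝ)) (z : E) : actE γ⁻¹ (actE γ z) = z := by
  rw [actE_mul, inv_mul_cancel, actE_one]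

/-- `actE γ⁻¹` is a right inverse of `actE γ` -/
theorem actE_actE_inv (γ : SL(2, ℝ)) (z : E) : actE γ (actE γ⁻¹ z) = z := by
  rw [actE_mul, mul_inv_cancel, actE_one]

/-- the image of a set under `actE γ` is the preimage under `actE γ⁻¹` -/
theorem image_actE_eq_preimage (γ : SL(2, ℝ)) (s : Set E) : actE γ '' s = actE γ⁻¹ ⁻¹' s :=
  congrFun (Set.image_eq_preimage_of_inverse (actE_inv_actE γ) (actE_actE_inv γ)) s

/-- `actE γ` is continuous (a linear map of a finite-dimensional space) -/
theorem continuous_actE (γ : SL(2, ℝ)) : Continuous (actE γ) :=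
  LinearMap.continuous_of_finiteDimensional _

/-- the image of a measurable set under `actE γ` is measurable -/
theorem measurableSet_image_actE (γ : SL(2, ℝ)) {s : Set E} (hs : MeasurableSet s) :
    MeasurableSet (actE γ '' s) := by
  rw [image_actE_eq_preimage]
  exact hs.preimage (continuous_actE γ⁻¹).measurable

/-- the determinant of the column action is `(det γ)² = 1` -/
theorem det_actF (γ : SL(2, ℝ)) : LinearMap.det (actF γ) = 1 := by
  rw [actF, LinearMap.det_prodMap, LinearMap.det_toLin', γ.det_coe, one_mul]

/-- the determinant of left multiplication in the orthogonal coordinates is `1` -/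
theorem det_actE (γ : SL(2, ℝ)) : LinearMap.det (actE γ) = 1 := by
  have h : actE γ = (Ψ.symm : F →ₗ[ℝ] E) ∘ₗ actF γ ∘ₗ (Ψ.symm.symm : E →ₗ[ℝ] F) := by
    rw [LinearEquiv.symm_symm]; rfl
  rw [h, LinearMap.det_conj, det_actF]

/-- Lebesgue measure on `E = ℝ² × ℝ²` is the product of the two plane measures, an additive Haar measure -/
theorem isAddHaarMeasure_volume_E : (volume : Measure E).IsAddHaarMeasure :=
  inferInstanceAs (((volume : Measure E₂).prod (volume : Measure E₂)).IsAddHaarMeasure)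

/-- LEFT MULTIPLICATION PRESERVES LEBESGUE MEASURE on `E` -/
theorem volume_image_actE (γ : SL(2, ℝ)) (s : Set E) : volume (actE γ '' s) = volume s := by
  haveI := isAddHaarMeasure_volume_E
  have := Measure.addHaar_image_linearMap (volume : Measure E) (actE γ) s
  rw [det_actE] at this
  simpa using this

/-! ## 3. The ball `B` around the identity and the entries of its points -/

/-- the orthogonal coordinates of the identity matrix: `p = (2, 0)`, `q = (0, 0)` -/
def z₁ : E := (!₂[(2 : ℝ), 0], !₂[(0 : ℝ), 0])

/-- `p₀ = 2` at the identity -/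
@[simp] theorem z₁_1_0 : z₁.1 0 = 2 := rfl
/-- `p₁ = 0` at the identity -/
@[simp] theorem z₁_1_1 : z₁.1 1 = 0 := rfl
/-- `q₀ = 0` at the identity -/
@[simp] theorem z₁_2_0 : z₁.2 0 = 0 := rfl
/-- `q₁ = 0` at the identity -/
@[simp] theorem z₁_2_1 : z₁.2 1 = 0 := rfl

/-- a coordinate of a point of the plane is bounded by the norm -/
theorem abs_apply_le_norm (p : E₂) (i : Fin 2) : |p i| ≤ ‖p‖ := by
  simpa [Real.norm_eq_abs] using PiLp.norm_apply_le p i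

/-- the coordinates of a point of `ball z₁ ε` -/
theorem coord_close {ε : ℝ} {z : E} (hz : z ∈ ball z₁ ε) :
    |z.1 0 - 2| < ε ∧ |z.1 1| < ε ∧ |z.2 0| < ε ∧ |z.2 1| < ε := by
  rw [mem_ball, Prod.dist_eq, max_lt_iff, dist_eq_norm, dist_eq_norm] at hz
  obtain ⟨h1, h2⟩ := hz
  have e10 := abs_apply_le_norm (z.1 - z₁.1) 0
  have e11 := abs_apply_le_norm (z.1 - z₁.1) 1
  have e20 := abs_apply_le_norm (z.2 - z₁.2) 0
  have e21 := abs_apply_le_norm (z.2 - z₁.2) 1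
  simp only [PiLp.sub_apply, z₁_1_0, z₁_1_1, z₁_2_0, z₁_2_1, sub_zero] at e10 e11 e20 e21
  exact ⟨lt_of_le_of_lt e10 h1, lt_of_le_of_lt e11 h1, lt_of_le_of_lt e20 h2, lt_of_le_of_lt e21 h2⟩

/-- the matrix of a point of `ball z₁ ε` has entries within `ε` of the identity -/
theorem entries_close {ε : ℝ} {z : E} (hz : z ∈ ball z₁ ε) :
    |mat (Ψ z) 0 0 - 1| < ε ∧ |mat (Ψ z) 0 1| < ε ∧ |mat (Ψ z) 1 0| < ε ∧ |mat (Ψ z) 1 1 - 1| < ε := by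
  obtain ⟨h1, h2, h3, h4⟩ := coord_close hz
  simp only [mat_apply_00, mat_apply_01, mat_apply_10, mat_apply_11, Ψ_apply_1, Ψ_apply_2]
  simp only [Matrix.cons_val_zero, Matrix.cons_val_one, Matrix.cons_val_fin_one]
  rw [abs_lt] at h1 h2 h3 h4 ⊢
  refine ⟨⟨?_, ?_⟩, ?_, ?_, ?_⟩
  · linarith
  · linarith
  · rw [abs_lt]; constructor <;> linarith
  · rw [abs_lt]; constructor <;> linarith
  · rw [abs_lt]; constructor <;> linarith

/-! ## 4. The `2 × 2` algebra: determinant near `1`, the explicit inverse, Cauchy–Schwarz -/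

/-- `|ad − bc − 1| < 4 ε` and `ad − bc ≥ 1/2` for entries within `ε ≤ 1/8` of the identity -/
theorem det_close {ε a b c d : ℝ} (hε : ε ≤ 1 / 8) (ha : |a - 1| < ε) (hb : |b| < ε) (hc : |c| < ε)
    (hd : |d - 1| < ε) : |a * d - b * c - 1| < 4 * ε ∧ 1 / 2 ≤ a * d - b * c := by
  rw [abs_lt] at ha hb hc hd
  have hε0 : 0 < ε := by linarith [abs_nonneg b]
  constructor
  · rw [abs_lt]
    constructor <;> nlinarith
  · nlinarith

/-- from `|D t| < 3 ε` and `D ≥ 1/2`: `|t| < 6 ε` -/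
theorem abs_lt_of_mul_lt {D t ε : ℝ} (hD : 1 / 2 ≤ D) (h : |D * t| < 3 * ε) : |t| < 6 * ε := by
  rw [abs_mul, abs_of_pos (by linarith)] at h
  nlinarith [abs_nonneg t]

/-- THE EXPLICIT `2 × 2` INVERSE: if `δ Y = Y'` with `Y, Y'` within `ε ≤ 1/8` of the identity, then `δ` is
within `6 ε` of the identity -/
theorem inv_close {ε a b c d a' b' c' d' x y u v : ℝ} (hε : ε ≤ 1 / 8)
    (ha : |a - 1| < ε) (hb : |b| < ε) (hc : |c| < ε) (hd : |d - 1| < ε)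
    (ha' : |a' - 1| < ε) (hb' : |b'| < ε) (hc' : |c'| < ε) (hd' : |d' - 1| < ε)
    (h1 : x * a + y * c = a') (h2 : x * b + y * d = b') (h3 : u * a + v * c = c') (h4 : u * b + v * d = d') :
    |x - 1| < 6 * ε ∧ |y| < 6 * ε ∧ |u| < 6 * ε ∧ |v - 1| < 6 * ε := by
  obtain ⟨-, hD⟩ := det_close hε ha hb hc hd
  have hε0 : 0 < ε := by linarith [abs_nonneg b]
  have hDx : (a * d - b * c) * (x - 1) = (a' - a) * d - (b' - b) * c := by linear_combination d * h1 - c * h2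
  have hDy : (a * d - b * c) * y = a * (b' - b) - (a' - a) * b := by linear_combination a * h2 - b * h1
  have hDu : (a * d - b * c) * u = (c' - c) * d - (d' - d) * c := by linear_combination d * h3 - c * h4
  have hDv : (a * d - b * c) * (v - 1) = a * (d' - d) - (c' - c) * b := by linear_combination a * h4 - b * h3
  have hb2 : |a' - a| < 2 * ε := by rw [abs_lt] at ha ha' ⊢; constructor <;> linarith
  have hb3 : |b' - b| < 2 * ε := by rw [abs_lt] at hb hb' ⊢; constructor <;> linarith
  have hb4 : |c' - c| < 2 * ε := by rw [abs_lt] at hc hc' ⊢; constructor <;> linarith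
  have hb5 : |d' - d| < 2 * ε := by rw [abs_lt] at hd hd' ⊢; constructor <;> linarith
  have hda : |a| ≤ 1 + ε := by rw [abs_lt] at ha; rw [abs_le]; constructor <;> linarith
  have hdd : |d| ≤ 1 + ε := by rw [abs_lt] at hd; rw [abs_le]; constructor <;> linarith
  have key : ∀ {s t : ℝ}, |s| < 2 * ε → |t| ≤ 1 + ε → |s * t| ≤ 2 * ε * (1 + ε) := fun hs ht => by
    rw [abs_mul]; exact mul_le_mul hs.le ht (abs_nonneg _) (by linarith)
  have key' : ∀ {s t : ℝ}, |s| < 2 * ε → |t| < ε → |s * t| ≤ 2 * ε * ε := fun hs ht => by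
    rw [abs_mul]; exact mul_le_mul hs.le ht.le (abs_nonneg _) (by linarith)
  have bound : 2 * ε * (1 + ε) + 2 * ε * ε < 3 * ε := by nlinarith
  refine ⟨abs_lt_of_mul_lt hD ?_, abs_lt_of_mul_lt hD ?_, abs_lt_of_mul_lt hD ?_, abs_lt_of_mul_lt hD ?_⟩
  · rw [hDx]
    calc |(a' - a) * d - (b' - b) * c| ≤ |(a' - a) * d| + |(b' - b) * c| := abs_sub _ _
      _ ≤ 2 * ε * (1 + ε) + 2 * ε * ε := add_le_add (key hb2 hdd) (key' hb3 hc)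
      _ < 3 * ε := bound
  · rw [hDy]
    calc |a * (b' - b) - (a' - a) * b| ≤ |a * (b' - b)| + |(a' - a) * b| := abs_sub _ _
      _ ≤ 2 * ε * (1 + ε) + 2 * ε * ε := by
        refine add_le_add ?_ (key' hb2 hb)
        rw [mul_comm]; exact key hb3 hda
      _ < 3 * ε := bound
  · rw [hDu]
    calc |(c' - c) * d - (d' - d) * c| ≤ |(c' - c) * d| + |(d' - d) * c| := abs_sub _ _
      _ ≤ 2 * ε * (1 + ε) + 2 * ε * ε := add_le_add (key hb4 hdd) (key' hb5 hc)
      _ < 3 * ε := bound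
  · rw [hDv]
    calc |a * (d' - d) - (c' - c) * b| ≤ |a * (d' - d)| + |(c' - c) * b| := abs_sub _ _
      _ ≤ 2 * ε * (1 + ε) + 2 * ε * ε := by
        refine add_le_add ?_ (key' hb4 hb)
        rw [mul_comm]; exact key hb5 hda
      _ < 3 * ε := bound

/-- Cauchy–Schwarz for the `2 × 2` product: `Σ (g y)² ≤ (Σ g²)(Σ y²)` -/
theorem sum_sq_mul_le (g00 g01 g10 g11 y00 y01 y10 y11 : ℝ) :
    (g00 * y00 + g01 * y10) ^ 2 + (g00 * y01 + g01 * y11) ^ 2 + (g10 * y00 + g11 * y10) ^ 2 +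
        (g10 * y01 + g11 * y11) ^ 2 ≤
      (g00 ^ 2 + g01 ^ 2 + g10 ^ 2 + g11 ^ 2) * (y00 ^ 2 + y01 ^ 2 + y10 ^ 2 + y11 ^ 2) := by
  nlinarith [sq_nonneg (g00 * y10 - g01 * y00), sq_nonneg (g00 * y11 - g01 * y01),
    sq_nonneg (g10 * y10 - g11 * y00), sq_nonneg (g10 * y11 - g11 * y01)]

/-- the sum of the squared entries of a matrix within `ε ≤ 1/8` of the identity is `≤ 4` -/
theorem sum_sq_le_four {ε a b c d : ℝ} (hε : ε ≤ 1 / 8) (ha : |a - 1| < ε) (hb : |b| < ε) (hc : |c| < ε)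
    (hd : |d - 1| < ε) : a ^ 2 + b ^ 2 + c ^ 2 + d ^ 2 ≤ 4 := by
  rw [abs_lt] at ha hb hc hd
  nlinarith

end

end Summit.Ventures.HodgeRepro2.Tier7.Line3.DiscreteSubgroupPacking
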